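import Summits.BirchSwinnertonDyer.BirchSwinnertonDyer.Theorems.PrintCFramBottomClassIndexLawFiveLeEisensteinAlgebraicMu
import Literature.NumberTheory.EllipticCurves.ZpExtensionDecompositionAbovePProofs
import HarnessLib

/-!
# Route `PrintCFram`, crux C2 `BottomClassIndexLawFiveLe` (stmt-BirchSwinnertonDyer-20372), line `eisenstein-resource-bdp-line`:
# the algebraic half of the invariant-match stub with Brink's hypothesis DISCHARGED and the auxiliary set FIXED
# (cell `bsd-print-cfram`, seat `bsd-line-cfram-p1` LEAD g3; helper `--supports` 20372; ONE theorem, 0 facts)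

HONEST FRAMING. Nothing about BSD is proved; the stub is NOT closed. Companion of `…EisensteinAlgebraicMu.lean` §3: the same
assembly `stub_invariantMatch_cmRamified_of_lineDevissage_of_analyticInequality` with `D_{𝔭'} ⊄ ker κ` supplied by the tree's
PROVED `ZpExtension.not_decomp_le_kerSubgroup_of_isImaginaryQuadratic` (Brink for an imaginary quadratic base) and the auxiliary set
taken to be the bad places prime to `p` (so `hS` is trivial). What (ALG′) still asks per frame: a `Γ_{K''}`-stable line `Φ ≤ W[p]`
with `(W[p]/Φ)^{G_{K''_{∞,𝔭'}}} = 0` and FINITE residual Selmer groups of `Φ`, `W[p]/Φ` (CGLS Prop. 14-type). BSD is not proved by any of this.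

References: Castella–Grossi–Lee–Skinner 2022 §3 [CastellaGrossiLeeSkinner2022]; Brink 2007 Thm. 2 [Brink2007].
-/

noncomputable section

open scoped Classical

set_option linter.dupNamespace false
set_option autoImplicit false

namespace Summit.BirchSwinnertonDyer.BirchSwinnertonDyer.Theorems.PrintCFram.EisensteinResourceBdpLine

open WeierstrassCurve NumberField IsDedekindDomain Field PowerSeries
  Literature.NumberTheory.EllipticCurves Literature.NumberTheory.EllipticCurves.GreenbergSelmer
  Literature.NumberTheory.EllipticCurves.ModularForms Literature.NumberTheory.EllipticCurves.Rank1Residual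
  Summit.BirchSwinnertonDyer.BirchSwinnertonDyer.Theorems.SchneiderFree
  Literature.NumberTheory.EllipticCurves.GreenbergVatsal2000
  Literature.NumberTheory.EllipticCurves.IwasawaAlgebra
  Literature.NumberTheory.GaloisRepresentations
  Summit.BirchSwinnertonDyer.Rank1Residual Summit.BirchSwinnertonDyer.Rank1Residual.X11b
  Summit.BirchSwinnertonDyer.Rank1Residual.X11b.AcSelmer
  Summit.BirchSwinnertonDyer.Rank1Residual.X2.ResidualDevissageModules
  Summit.BirchSwinnertonDyer.BirchSwinnertonDyer.Theorems.CumulativeHeegnerInclusionAtThreeResidualDevissage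
  Summit.BirchSwinnertonDyer.BirchSwinnertonDyer.Theorems.UniversalToricDescentAcDualMuZero

/-! ## The §3 assembly of the companion with Brink DISCHARGED and the auxiliary set FIXED to the bad places prime to `p` -/

section AssemblyRefined

/-- **Registered `stub_invariantMatch_cmRamified` (verbatim) ⟸ (ALG′) ∧ (AN)**, where (ALG′) asks at each frame ONLY for a
`Γ_{K''}`-stable line `Φ ≤ W[p]` over `K''` with `(W[p]/Φ)^{G_{K''_{∞,𝔭'}}} = 0` and FINITE residual Selmer groups of `Φ` and `W[p]/Φ`
(strict at `𝔭'`, unramified outside the bad places prime to `p`) — Brink's `D_{𝔭'} ⊄ ker κ` is DISCHARGED by the tree's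
`ZpExtension.not_decomp_le_kerSubgroup_of_isImaginaryQuadratic` (`K''` imaginary quadratic is a frame binder) and the auxiliary set is the
bad set itself. (AN) as in §3. CONDITIONAL on (ALG′), (AN); closes nothing; BSD is not proved by any of this.
[cite: CastellaGrossiLeeSkinner2022, §3 Props. 14, 17, 18 (arXiv:2008.02571 §1)] [cite: Brink2007, Thm. 2] -/
theorem stub_invariantMatch_cmRamified_of_line_of_analyticInequality
    (hline : ∀ (p : ℕ) [Fact p.Prime] (W : WeierstrassCurve ℚ) [W.IsElliptic] [W.IsGloballyMinimal],
      W.HasCM → CMRamified W p → 5 ≤ p → W.analyticRank = 1 →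
      ∀ (N : ℕ) [NeZero N] (K : Type) [Field K] [NumberField K] (Dt : ModularParametrizationData W N),
      W.conductorNorm ℤ = N → IsImaginaryQuadratic K → SatisfiesHeegnerHypothesis N K →
      ∀ (κ : ZpExtension K p), κ.IsAnticyclotomic → ∀ (γ : Field.absoluteGaloisGroup K) [Fact (κ.IsTopGenerator γ)]
        (𝔭 : HeightOneSpectrum (𝓞 K)), ((p : ℕ) : 𝓞 K) ∈ 𝔭.asIdeal → 𝔭.asIdeal.ramificationIdx (𝓞 ℚ) = 1 →
        𝔭.asIdeal.inertiaDeg (𝓞 ℚ) = 1 → ∀ (𝔭' : HeightOneSpectrum (𝓞 K)), ((p : ℕ) : 𝓞 K) ∈ 𝔭'.asIdeal → 𝔭' ≠ 𝔭 →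
        ∀ (ι' : PadicAlgCl p ≃+* ℂ), SchneiderFree.BranchInducesPrime p ι' 𝔭 →
        ∀ (ΩK : ℂ) (Ωp : ℂ_[p]) (Q : PowerSeries (PadicComplexInt p)), ΩK ≠ 0 → Ωp ≠ 0 →
          R1.IsBDPLFunctionInt p ι' 𝔭 κ γ Dt.f ΩK Ωp Q →
          ∃ Φ : StableSubgroup (absoluteGaloisGroup K) ((W.baseChange K).geomTorsion (p : ℤ)),
            (∀ y : Φ.Quot, (∀ g : ↥(κ.kerSubgroup ⊓ decomp 𝔭'), g • y = y) → y = 0) ∧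
            (datumStrictSelmer κ.kerSubgroup Φ.Sub p (AcSelmer.bdpData Φ.Sub p 𝔭')
                {v : HeightOneSpectrum (𝓞 K) | ¬ (W.baseChange K).HasGoodReductionAt v ∧ ((p : ℕ) : 𝓞 K) ∉ v.asIdeal} :
              Set (subgroupH1 κ.kerSubgroup Φ.Sub)).Finite ∧
            (datumStrictSelmer κ.kerSubgroup Φ.Quot p (AcSelmer.bdpData Φ.Quot p 𝔭')
                {v : HeightOneSpectrum (𝓞 K) | ¬ (W.baseChange K).HasGoodReductionAt v ∧ ((p : ℕ) : 𝓞 K) ∉ v.asIdeal} :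
              Set (subgroupH1 κ.kerSubgroup Φ.Quot)).Finite)
    (han : ∀ (p : ℕ) [Fact p.Prime] (W : WeierstrassCurve ℚ) [W.IsElliptic] [W.IsGloballyMinimal],
      W.HasCM → CMRamified W p → 5 ≤ p → W.analyticRank = 1 →
      ∀ (N : ℕ) [NeZero N] (K : Type) [Field K] [NumberField K] (Dt : ModularParametrizationData W N),
      W.conductorNorm ℤ = N → IsImaginaryQuadratic K → SatisfiesHeegnerHypothesis N K →
      ∀ (κ : ZpExtension K p), κ.IsAnticyclotomic → ∀ (γ : Field.absoluteGaloisGroup K) [Fact (κ.IsTopGenerator γ)]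
        (𝔭 : HeightOneSpectrum (𝓞 K)), ((p : ℕ) : 𝓞 K) ∈ 𝔭.asIdeal → 𝔭.asIdeal.ramificationIdx (𝓞 ℚ) = 1 →
        𝔭.asIdeal.inertiaDeg (𝓞 ℚ) = 1 → ∀ (𝔭' : HeightOneSpectrum (𝓞 K)), ((p : ℕ) : 𝓞 K) ∈ 𝔭'.asIdeal → 𝔭' ≠ 𝔭 →
        ∀ (ι' : PadicAlgCl p ≃+* ℂ), SchneiderFree.BranchInducesPrime p ι' 𝔭 →
        ∀ (ΩK : ℂ) (Ωp : ℂ_[p]) (Q : PowerSeries (PadicComplexInt p)), ΩK ≠ 0 → Ωp ≠ 0 →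
          R1.IsBDPLFunctionInt p ι' 𝔭 κ γ Dt.f ΩK Ωp Q →
          ∀ m < lambdaInvariant p (XAc (W.baseChange K) p κ 𝔭' ∅ γ),
            ‖((PowerSeries.coeff m Q : PadicComplexInt p) : ℂ_[p])‖ < 1) :
    ∀ (p : ℕ) [Fact p.Prime] (W : WeierstrassCurve ℚ) [W.IsElliptic] [W.IsGloballyMinimal],
      W.HasCM → CMRamified W p → 5 ≤ p → W.analyticRank = 1 →
      ∀ (N : ℕ) [NeZero N] (K : Type) [Field K] [NumberField K] (Dt : ModularParametrizationData W N),
      W.conductorNorm ℤ = N → IsImaginaryQuadratic K → SatisfiesHeegnerHypothesis N K →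
      ∀ (κ : ZpExtension K p), κ.IsAnticyclotomic → ∀ (γ : Field.absoluteGaloisGroup K) [Fact (κ.IsTopGenerator γ)]
        (𝔭 : HeightOneSpectrum (𝓞 K)), ((p : ℕ) : 𝓞 K) ∈ 𝔭.asIdeal → 𝔭.asIdeal.ramificationIdx (𝓞 ℚ) = 1 →
        𝔭.asIdeal.inertiaDeg (𝓞 ℚ) = 1 → ∀ (𝔭' : HeightOneSpectrum (𝓞 K)), ((p : ℕ) : 𝓞 K) ∈ 𝔭'.asIdeal → 𝔭' ≠ 𝔭 →
        ∀ (ι' : PadicAlgCl p ≃+* ℂ), SchneiderFree.BranchInducesPrime p ι' 𝔭 →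
        ∀ (ΩK : ℂ) (Ωp : ℂ_[p]) (Q : PowerSeries (PadicComplexInt p)), ΩK ≠ 0 → Ωp ≠ 0 →
          R1.IsBDPLFunctionInt p ι' 𝔭 κ γ Dt.f ΩK Ωp Q →
          ∃ n : ℕ, (∀ m < n, ‖((PowerSeries.coeff m Q : 𝓞_ℂ_[p]) : ℂ_[p])‖ < 1) ∧
            ∃ G ∈ (XAc.charIdeal (W.baseChange K) p κ 𝔭' ∅ γ).map (PowerSeries.map (R1.toCpInt p)),
              ‖((PowerSeries.coeff n G : 𝓞_ℂ_[p]) : ℂ_[p])‖ = 1 := by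
  refine stub_invariantMatch_cmRamified_of_lineDevissage_of_analyticInequality ?_ han
  intro p _ W _ _ hCM hram h5 hr N _ K _ _ Dt hN hK hHN κ hκ γ _ 𝔭 h𝔭 he hf 𝔭' h𝔭' hne ι' hind ΩK Ωp Q hΩK hΩp hBDP
  obtain ⟨Φ, hfix, hΦ, hΨ⟩ :=
    hline p W hCM hram h5 hr N K Dt hN hK hHN κ hκ γ 𝔭 h𝔭 he hf 𝔭' h𝔭' hne ι' hind ΩK Ωp Q hΩK hΩp hBDP
  exact ⟨ZpExtension.not_decomp_le_kerSubgroup_of_isImaginaryQuadratic hK κ (by exact_mod_cast h𝔭'),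
    _, Φ, fun v hv hpv => by
      by_contra hbad
      exact hv ⟨hbad, hpv⟩, hfix, hΦ, hΨ⟩

end AssemblyRefined

end Summit.BirchSwinnertonDyer.BirchSwinnertonDyer.Theorems.PrintCFram.EisensteinResourceBdpLine

end
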